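import Literature.NumberTheory.Transcendental.RoySmallValueStep2Pkg
import Literature.NumberTheory.Transcendental.RoySmallValueOrbitSelection
import Literature.NumberTheory.Transcendental.RoySmallValueDescentK
import HarnessLib

/-!
# Roy's small value estimate for `𝔾ₐ × 𝔾ₘ` — §7 Step 2: the selected orbit `Z ⊆ 𝒵(P̃, Q)` and its `h_𝒞`-bound

Topic `Literature/NumberTheory/Transcendental`. Part of the formalisation of the proof of Roy 2013,
Theorem 1.1 (named fact `roy2013_thm_1_1`, `RoySmallValueEstimates.lean`), seat B. Source: D. Roy,
*A small value estimate for `𝔾ₐ × 𝔾ₘ`*, Mathematika 59 (2013) 333–363 = arXiv:1301.0663,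
Proposition 6.4 and §7, Step 2 (pp. 17–18 of the arXiv text):

> **Proposition 6.4.** [...] Then there is a zero-dimensional subvariety `Z` of `ℙ²_ℚ` contained in
> `𝒵(𝒟ⁱP ; 0 ≤ i < 2T)` with `h_𝒞(Z) ≤ −C''(Y deg(Z) + D h(Z))`.
> (Step 2) [...] there exists a 0-dimensional subvariety `Z = Z_D` [...] such that
> `h_{𝒞_D}(Z) ≤ −(D^δ/25)(2D^β deg(Z) + D h(Z))` [...]
> `∑_{α∈Z} log sup{|P(α)| ; P ∈ 𝒞_D} ≤ h_{𝒞_D}(Z) − D h(Z) + 9 log(3) D deg(Z)`.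

With `Z` an ORBIT `O` of the normalised representatives of `𝒵(P̃, Q)` under `Aut(K/ℚ)`, the
statement proved here (`LevelPkg.exists_orbit_step2`) is: for a level package `L`, Roy's body
`𝒞 = royBody D ξ η Y U T ∋ P̃, Q`, a weight `Y_w` and `B ≥ Y_w D² + (1/[K:ℚ])∑_j e_j D h_K(rep j)`,
if `ε := 2^{2k2^k} e^{−TU} N! (3e^Y)^N e^{Y_w D²} < 1` then THERE IS AN ORBIT `O` such that for
EVERY family `(R_j)_{j∈O}` of elements of `𝒞`,

  `∏_{j∈O} ( |R_j(α_j)|/‖α_j‖^D · e^{Y_w + D h_K(rep j)/[K:ℚ]} ) ≤ ε^{w(O)/B}`,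
  `w(O) = Y_w #O + (D/[K:ℚ]) ∑_{j∈O} h_K(rep j)`

— i.e. in logarithmic form `∑_{j∈O} log(|R_j(α_j)|/‖α_j‖^D) ≤ (log ε / B − 1)·w(O)`, Roy's
`h_𝒞(Z) ≤ −C''(Y deg Z + D h(Z))` combined with `∑ log sup ≤ h_𝒞(Z) − D h(Z) + …`, for test
families. Ingredients: `step2_family_normalised_le` (`RoySmallValueStep2Pkg`), the orbit selection
`ZeroConfigK.exists_orb_forall_prod_le` (`RoySmallValueOrbitSelection`) with the multiplicities
constant on orbits (`mult_perm`, `RoySmallValueDescentK`), and the partition of the index set into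
orbits (`sum_orbits_eq`). Everything is proved; no definitions, no named facts.

## References

* [Roy2013] D. Roy, *A small value estimate for 𝔾ₐ × 𝔾ₘ*, Mathematika 59 (2013), 333–363
  (arXiv:1301.0663), Propositions 6.2, 6.4, 2.4 and §7, Step 2.
-/

noncomputable section

open MvPolynomial Finset Height

namespace Literature.NumberTheory.Transcendental

namespace Roy2013

/-! ### Sums over the partition into orbits -/

namespace ZeroConfigK

variable {K : IntermediateField ℚ ℂ} {ι : Type*} [Fintype ι] [DecidableEq ι] (Z : ZeroConfigK K ι)
  [NumberField K]

/-- An orbit is the fibre of the orbit map. [folklore] -/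
theorem orb_eq_filter (c : ι) : Z.orb c = univ.filter (fun x => Z.orb x = Z.orb c) := by
  ext x
  simp only [mem_filter, mem_univ, true_and]
  constructor
  · intro hx; exact Z.orb_eq_of_mem hx
  · intro hx; rw [← hx]; exact Z.self_mem_orb x

/-- **Summing over orbits, then inside each orbit, is summing over all points.** [folklore] -/
theorem sum_orbits_eq {M : Type*} [AddCommMonoid M] (f : ι → M) :
    ∑ O ∈ univ.image Z.orb, ∑ i ∈ O, f i = ∑ j, f j := by
  refine Finset.sum_image' (s := univ) (g := Z.orb) (f := fun O => ∑ i ∈ O, f i) f fun c _ => ?_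
  show ∑ i ∈ Z.orb c, f i = _
  conv_lhs => rw [Z.orb_eq_filter c]

end ZeroConfigK

/-! ### Step 2 for a level package: the selected orbit -/

namespace LevelPkg

variable {D : ℕ} {Pt : MvPolynomial (Fin 3) ℤ} (L : LevelPkg D Pt)

/-- **Roy 2013, Proposition 6.4 / §7 Step 2 (the orbit `Z` and its bound).** See the module
docstring. [cite: Roy2013, Proposition 6.4 and §7, Step 2] -/
theorem exists_orbit_step2 (hPt : (map (Int.castRingHom ℂ) Pt).IsHomogeneous D)
    {ξ η : ℂ} (hη : η ≠ 0) {T Li : ℕ} (hTL : T ≤ (Li + 2).choose 2) (hLD : Li ≤ D) {Y U : ℝ}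
    (hU : 0 ≤ U)
    (hY : (3 * (1 + ‖ξ‖ + ‖η‖⁻¹)) ^ Li * (4 * (Li + 1) : ℝ) ^ (Li + 2).choose 2 ≤ Real.exp Y)
    (hPmem : map (Int.castRingHom ℂ) Pt ∈ royBody D ξ η Y U T)
    (hQmem : map (Int.castRingHom ℂ) (levelQ D Pt L.t) ∈ royBody D ξ η Y U T)
    {k : ℕ} (hk : D ^ 2 ≤ 2 ^ k) (K : IntermediateField ℚ ℂ) (hK : ∀ i k, L.α i k ∈ K)
    [Normal ℚ K] [NumberField K] {Yw B : ℝ} (hB0 : 0 < B)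
    (hB : Yw * D ^ 2 + (∑ i, (L.e i : ℝ) * (D * logHeight ((L.cfg K hK).rep i))) /
      Module.finrank ℚ K ≤ B)
    (hε : 2 ^ (2 * k * 2 ^ k) * (Real.exp (-(T * U)) *
        ((Fintype.card (PhiRow D)).factorial * (3 * Real.exp Y) ^ Fintype.card (PhiRow D))) *
        Real.exp (Yw * D ^ 2) < 1) :
    ∃ j₀ : Fin L.m, ∀ t : Fin L.m → CX, (∀ j ∈ (L.cfg K hK).orb j₀, t j ∈ royBody D ξ η Y U T) →
      ∏ j ∈ (L.cfg K hK).orb j₀,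
          (‖eval (L.α j) (t j)‖ / ‖L.α j‖ ^ D *
            Real.exp (Yw + D * logHeight ((L.cfg K hK).rep j) / Module.finrank ℚ K)) ≤
        (2 ^ (2 * k * 2 ^ k) * (Real.exp (-(T * U)) *
          ((Fintype.card (PhiRow D)).factorial * (3 * Real.exp Y) ^ Fintype.card (PhiRow D))) *
          Real.exp (Yw * D ^ 2)) ^
          ((Yw * ((L.cfg K hK).orb j₀).card +
            D * (∑ j ∈ (L.cfg K hK).orb j₀, logHeight ((L.cfg K hK).rep j)) /
              Module.finrank ℚ K) / B) := by
  classical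
  -- abbreviations: heights, the constant `S₀`, `n = [K:ℚ]`
  obtain ⟨h, hh⟩ : ∃ h : Fin L.m → ℝ, h = fun j => logHeight ((L.cfg K hK).rep j) := ⟨_, rfl⟩
  have hhj : ∀ j, logHeight ((L.cfg K hK).rep j) = h j := fun j => by rw [hh]
  have hh0 : ∀ j, 0 ≤ h j := fun j => by rw [hh]; exact logHeight_nonneg _
  obtain ⟨S₀, hS₀⟩ : ∃ S₀ : ℝ, S₀ = 2 ^ (2 * k * 2 ^ k) * (Real.exp (-(T * U)) *
      ((Fintype.card (PhiRow D)).factorial * (3 * Real.exp Y) ^ Fintype.card (PhiRow D))) :=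
    ⟨_, rfl⟩
  obtain ⟨n, hn⟩ : ∃ n : ℝ, n = Module.finrank ℚ K := ⟨_, rfl⟩
  have hn0 : 0 < n := by rw [hn]; exact_mod_cast Module.finrank_pos
  simp only [hhj, ← hS₀, ← hn] at hB hε ⊢
  -- the weighted tests, the multiplicities on orbits, the weights
  obtain ⟨v, hv⟩ : ∃ v : Fin L.m → CX → ℝ,
      v = fun j R => ‖eval (L.α j) R‖ / ‖L.α j‖ ^ D * Real.exp (Yw + D * h j / n) := ⟨_, rfl⟩
  have heconst : ∀ g j, L.e ((L.cfg K hK).perm g j) = L.e j := fun g j =>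
    mult_perm (L.cfg K hK) (L.map_intF_eq_prod K hK) (L.hemax_cfg K hK) g j
  have hemem : ∀ c, ∀ j ∈ (L.cfg K hK).orb c, L.e j = L.e c := by
    intro c j hj
    obtain ⟨-, g, rfl⟩ := mem_filter.mp hj
    exact heconst g c
  obtain ⟨eO, heO⟩ : ∃ eO : Finset (Fin L.m) → ℕ,
      eO = fun O => if hO : O.Nonempty then L.e (O.min' hO) else 0 := ⟨_, rfl⟩
  have heO' : ∀ j, eO ((L.cfg K hK).orb j) = L.e j := by
    intro j
    have hne : ((L.cfg K hK).orb j).Nonempty := ⟨j, (L.cfg K hK).self_mem_orb j⟩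
    rw [heO]
    simp only [hne, dite_true]
    exact hemem j _ (Finset.min'_mem _ hne)
  obtain ⟨w, hw⟩ : ∃ w : Finset (Fin L.m) → ℝ,
      w = fun O => Yw * O.card + D * (∑ j ∈ O, h j) / n := ⟨_, rfl⟩
  -- `∑ e_j = D²`
  have hesum : ∑ j, (L.e j : ℝ) = (D : ℝ) ^ 2 := by
    have := L.hesum; rw [L.hcard] at this; exact_mod_cast this
  -- the sum of the weights
  have hsum : ∑ O ∈ univ.image (L.cfg K hK).orb, (eO O : ℝ) * w O ≤ B := by
    have hwO : ∀ O : Finset (Fin L.m),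
        Yw * O.card + D * (∑ j ∈ O, h j) / n = ∑ j ∈ O, (Yw + D * h j / n) := by
      intro O
      rw [sum_add_distrib, sum_const, nsmul_eq_mul, mul_sum, sum_div, mul_comm]
    have h1 : ∀ O ∈ univ.image (L.cfg K hK).orb,
        (eO O : ℝ) * w O = ∑ j ∈ O, (L.e j : ℝ) * (Yw + D * h j / n) := by
      intro O hO
      obtain ⟨c, -, rfl⟩ := mem_image.mp hO
      rw [heO' c, hw]
      show (L.e c : ℝ) * (Yw * ((L.cfg K hK).orb c).card + D * (∑ j ∈ (L.cfg K hK).orb c, h j) / n) = _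
      have h2 : ∀ j ∈ (L.cfg K hK).orb c, (L.e j : ℝ) * (Yw + D * h j / n) =
          (L.e c : ℝ) * (Yw + D * h j / n) := fun j hj => by rw [hemem c j hj]
      rw [Finset.sum_congr rfl h2, ← mul_sum, hwO]
    rw [Finset.sum_congr rfl h1, (L.cfg K hK).sum_orbits_eq (fun j => (L.e j : ℝ) * (Yw + D * h j / n))]
    have h3 : ∑ j, (L.e j : ℝ) * (Yw + D * h j / n) =
        Yw * ∑ j, (L.e j : ℝ) + (∑ j, (L.e j : ℝ) * (D * h j)) / n := by
      rw [mul_sum, sum_div, ← sum_add_distrib]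
      refine Finset.sum_congr rfl fun j _ => ?_
      ring
    rw [h3, hesum]
    exact hB
  -- the test-family inequality
  have hS₀0 : 0 ≤ S₀ := by rw [hS₀]; positivity
  have hε0 : 0 < S₀ * Real.exp (Yw * D ^ 2) := by
    rcases hS₀0.lt_or_eq with hlt | heq
    · exact mul_pos hlt (Real.exp_pos _)
    · exfalso
      rw [← heq, zero_mul] at hε
      -- `S₀ = 0` is impossible (all factors positive), but `0 < 1` makes `hε` harmless; derive `S₀ > 0`
      rw [hS₀] at heq
      have : (0 : ℝ) < 2 ^ (2 * k * 2 ^ k) * (Real.exp (-(T * U)) *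
          ((Fintype.card (PhiRow D)).factorial * (3 * Real.exp Y) ^ Fintype.card (PhiRow D))) := by
        positivity
      linarith
  have H : ∀ t : Fin L.m → CX, (∀ j, t j ∈ royBody D ξ η Y U T) →
      ∏ j, v j (t j) ^ L.e j ≤ S₀ * Real.exp (Yw * D ^ 2) := by
    intro t ht
    have hcore := L.step2_family_normalised_le hPt hη hTL hLD hU hY hPmem hQmem hk K hK t ht
    simp only [hhj, ← hS₀, ← hn] at hcore
    rw [hv]
    simp only [mul_pow, prod_mul_distrib]
    have hexp : ∏ j, Real.exp (Yw + D * h j / n) ^ L.e j =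
        Real.exp (Yw * D ^ 2 + (∑ j, (L.e j : ℝ) * (D * h j)) / n) := by
      rw [← hesum]
      simp_rw [← Real.exp_nat_mul]
      rw [← Real.exp_sum]
      congr 1
      rw [mul_sum, sum_div, ← sum_add_distrib]
      refine Finset.sum_congr rfl fun j _ => ?_
      ring
    rw [hexp]
    calc (∏ j, (‖eval (L.α j) (t j)‖ / ‖L.α j‖ ^ D) ^ L.e j) *
          Real.exp (Yw * D ^ 2 + (∑ j, (L.e j : ℝ) * (D * h j)) / n)
        ≤ S₀ * Real.exp (-((∑ j, (L.e j : ℝ) * (D * h j)) / n)) *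
          Real.exp (Yw * D ^ 2 + (∑ j, (L.e j : ℝ) * (D * h j)) / n) :=
          mul_le_mul_of_nonneg_right hcore (Real.exp_pos _).le
      _ = S₀ * Real.exp (Yw * D ^ 2) := by
          rw [mul_assoc, ← Real.exp_add]
          congr 2
          ring
  -- the selection
  obtain ⟨j₀, hj₀⟩ := (L.cfg K hK).exists_orb_forall_prod_le L.e eO heO' L.he1 w
    (fun R => R ∈ royBody D ξ η Y U T) v hε0 hε hB0 hsum H
  refine ⟨j₀, fun t ht => ?_⟩
  have h := hj₀ t ht
  rw [hv, hw] at h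
  exact h

end LevelPkg

end Roy2013

end Literature.NumberTheory.Transcendental
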